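import Summits.QuantumFields.YangMills.Theorems.RationalShortRootRigidityWickE0
import Summits.QuantumFields.YangMills.Theorems.RationalShortRootRigidityReducedInvariance
import Summits.QuantumFields.YangMills.Theorems.RationalShortRootRigidityStieltjesTransfer
import Summits.QuantumFields.YangMills.Theorems.RationalShortRootRigidityFullDegMul
import Summits.QuantumFields.YangMills.Theorems.RationalShortRootRigidityWickHalf
import HarnessLib

/-!
# `RationalShortRootRigidity` — Step 1 ASSEMBLED: `stub_reduce` of the birth skeleton (v2)

Helper theorem INSIDE the paper proof of crux `stmt-QuantumFields-23124` (`F4SubCurvatureDoor.RationalShortRootRigidity`,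
LINE g15-A of planner ym-idea-3): the statement of `stub_reduce` of the owner's birth skeleton v2
(HOME l15/RationalShortRootRigidity-birth-v2.lean) with every skeleton definition (`IsB4Inv`, `IsHalfInv`, `FullDeg`, `AxisStieltjes`,
`WickAlong`, `e0`, `half`) unfolded, assembled along HOME l15/STUB-PLAN-Reduce.md:

1. `UniqueFactorizationMonoid.exists_reduced_factors` — a relatively prime pair `(N₀, D₀)` with `N = N₀ H`, `D = D₀ H`;
2. full degree of `D₀` and `H` (`fullDegMul`, p665383); 3. the budget `deg N₀ ≤ deg D₀ + 2` (`totalDegree_mul_of_isDomain`);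
4. axis-Stieltjes transfer (`stieltjesTransfer`, p668794); 5. honest invariance (`invariance_of_reduced`, p673030);
6. Wick-hyperbolicity along `e₀` (`wickAlong_e0_of_reduced`, p672858); 7. along `half = ½(1,1,1,1)` by transporting `e₀` to `half` with
the Weyl element `ε₁₂₃ ∘ s` (`wickAlong_half_of_wickAlong_e0`, tree file `RationalShortRootRigidityWickHalf.lean`, seat sfw-p2-w4).
`stub_reduce` carries the v2 conclusion (with `IsRelPrime N₀ D₀`); `stub_reduce'` is the v1 projection, literally the hypothesis of
`rationalShortRootRigidity_of_reduce` (p673165).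

Mathlib + tree helpers only; THEOREMS ONLY; no named facts; no `sorry`; default heartbeats.  This is ONE of the four stubs of the
birth skeleton; nothing about the crux 23124 itself, the route's rung or the Yang–Mills mass gap is proved here.  Free-hands seat
`ym-line-frs-p2` g10, `--supports stmt-QuantumFields-23124`.
-/

set_option autoImplicit false

namespace Summit.QuantumFields.YangMills.Theorems.RationalShortRootRigidity

open scoped BigOperators

/-- **`stub_reduce` of the birth skeleton v2** (Step 1 of the paper proof of crux 23124): reduction to a relatively prime, honestly
invariant, doubly Wick-hyperbolic axis-Stieltjes pair — every skeleton definition unfolded. [folklore assembly] -/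
theorem stub_reduce :
    ∀ N D : MvPolynomial (Fin 4) ℝ,
      (∀ (σ : Equiv.Perm (Fin 4)) (ε : Fin 4 → ℝ), (∀ i, ε i = 1 ∨ ε i = -1) →
        ∀ p : Fin 4 → ℝ, MvPolynomial.eval (fun i => ε i * p (σ i)) N = MvPolynomial.eval p N) →
      (∀ (σ : Equiv.Perm (Fin 4)) (ε : Fin 4 → ℝ), (∀ i, ε i = 1 ∨ ε i = -1) →
        ∀ p : Fin 4 → ℝ, MvPolynomial.eval (fun i => ε i * p (σ i)) D = MvPolynomial.eval p D) →
      (∀ p : Fin 4 → ℝ, MvPolynomial.eval (fun i => p i - (∑ j, p j) / 2) N = MvPolynomial.eval p N) →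
      (∀ p : Fin 4 → ℝ, MvPolynomial.eval (fun i => p i - (∑ j, p j) / 2) D = MvPolynomial.eval p D) →
      MvPolynomial.coeff (Finsupp.single 0 D.totalDegree) D ≠ 0 →
      N.totalDegree ≤ D.totalDegree + 2 →
      (∀ q : Fin 3 → ℝ, q ≠ 0 → ∃ (k : ℕ) (ω r : Fin k → ℝ) (c : Polynomial ℝ),
        (∀ j, 0 < ω j) ∧ (∀ j, 0 ≤ r j) ∧
        ∀ t : ℝ, MvPolynomial.eval (Fin.cons t q) N =
          MvPolynomial.eval (Fin.cons t q) D * (c.eval (t ^ 2) + ∑ j, r j / (t ^ 2 + ω j ^ 2))) →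
      ∃ N₀ D₀ : MvPolynomial (Fin 4) ℝ, N * D₀ = D * N₀ ∧ D₀ ≠ 0 ∧ IsRelPrime N₀ D₀ ∧
        (∀ (σ : Equiv.Perm (Fin 4)) (ε : Fin 4 → ℝ), (∀ i, ε i = 1 ∨ ε i = -1) →
          ∀ p : Fin 4 → ℝ, MvPolynomial.eval (fun i => ε i * p (σ i)) N₀ = MvPolynomial.eval p N₀) ∧
        (∀ (σ : Equiv.Perm (Fin 4)) (ε : Fin 4 → ℝ), (∀ i, ε i = 1 ∨ ε i = -1) →
          ∀ p : Fin 4 → ℝ, MvPolynomial.eval (fun i => ε i * p (σ i)) D₀ = MvPolynomial.eval p D₀) ∧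
        (∀ p : Fin 4 → ℝ, MvPolynomial.eval (fun i => p i - (∑ j, p j) / 2) N₀ = MvPolynomial.eval p N₀) ∧
        (∀ p : Fin 4 → ℝ, MvPolynomial.eval (fun i => p i - (∑ j, p j) / 2) D₀ = MvPolynomial.eval p D₀) ∧
        MvPolynomial.coeff (Finsupp.single 0 D₀.totalDegree) D₀ ≠ 0 ∧
        N₀.totalDegree ≤ D₀.totalDegree + 2 ∧
        (∀ q : Fin 3 → ℝ, q ≠ 0 → ∃ (k : ℕ) (ω r : Fin k → ℝ) (c : Polynomial ℝ),
          (∀ j, 0 < ω j) ∧ (∀ j, 0 ≤ r j) ∧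
          ∀ t : ℝ, MvPolynomial.eval (Fin.cons t q) N₀ =
            MvPolynomial.eval (Fin.cons t q) D₀ * (c.eval (t ^ 2) + ∑ j, r j / (t ^ 2 + ω j ^ 2))) ∧
        (∀ q : Fin 4 → ℝ, (∑ i, q i * (fun i : Fin 4 => if i = 0 then (1 : ℝ) else 0) i) = 0 →
          ∀ z : ℂ, MvPolynomial.aeval
            (fun i => z * ((fun i : Fin 4 => if i = 0 then (1 : ℝ) else 0) i : ℂ) + (q i : ℂ)) D₀ = 0 → z.re = 0) ∧
        (∀ q : Fin 4 → ℝ, (∑ i, q i * (fun _ : Fin 4 => (1 : ℝ) / 2) i) = 0 →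
          ∀ z : ℂ, MvPolynomial.aeval (fun i => z * ((fun _ : Fin 4 => (1 : ℝ) / 2) i : ℂ) + (q i : ℂ)) D₀ = 0 →
            z.re = 0) := by
  intro N D hBN hBD hHN hHD hfull hdeg hAS
  have hD0 : D ≠ 0 := fun h => hfull (by rw [h, MvPolynomial.coeff_zero])
  -- 1. reduced factors
  obtain ⟨D₀, N₀, H, hrel, hDfac, hNfac⟩ := UniqueFactorizationMonoid.exists_reduced_factors D hD0 N
  have hcop : IsRelPrime N₀ D₀ := hrel.symm
  have hDfac' : D = D₀ * H := by rw [mul_comm]; exact hDfac.symm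
  have hNfac' : N = N₀ * H := by rw [mul_comm]; exact hNfac.symm
  have hH0 : H ≠ 0 := by rintro rfl; rw [zero_mul] at hDfac; exact hD0 hDfac.symm
  have hD₀0 : D₀ ≠ 0 := by rintro rfl; rw [mul_zero] at hDfac; exact hD0 hDfac.symm
  -- 2. full degree of `D₀` and `H`
  have hfull2 := (fullDegMul D₀ H hD₀0 hH0).1 (by rw [← hDfac']; exact hfull)
  -- 3. budget
  have hbudget : N₀.totalDegree ≤ D₀.totalDegree + 2 := by
    by_cases hN₀0 : N₀ = 0
    · rw [hN₀0, MvPolynomial.totalDegree_zero]; exact Nat.zero_le _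
    · have h1 : N.totalDegree = N₀.totalDegree + H.totalDegree := by
        rw [hNfac', MvPolynomial.totalDegree_mul_of_isDomain hN₀0 hH0]
      have h2 : D.totalDegree = D₀.totalDegree + H.totalDegree := by
        rw [hDfac', MvPolynomial.totalDegree_mul_of_isDomain hD₀0 hH0]
      omega
  -- 4. axis-Stieltjes transfer
  have hAS₀ := stieltjesTransfer N D N₀ D₀ H hNfac' hDfac' hfull2.2 hAS
  -- 5. honest invariance
  obtain ⟨hBN₀, hBD₀, hHN₀, hHD₀⟩ := invariance_of_reduced N D N₀ D₀ H hBN hBD hHN hHD hNfac' hDfac' hD0 hcop hfull2.1 hAS₀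
  -- 6./7. Wick-hyperbolicity along `e₀` and along `half`
  have hWe0 := wickAlong_e0_of_reduced N₀ D₀ hcop hfull2.1 hAS₀
  have hWhalf := wickAlong_half_of_wickAlong_e0 D₀ hBD₀ hHD₀ hWe0
  refine ⟨N₀, D₀, ?_, hD₀0, hcop, hBN₀, hBD₀, hHN₀, hHD₀, hfull2.1, hbudget, hAS₀, hWe0, hWhalf⟩
  rw [hNfac', hDfac']; ring

/-- **`stub_reduce`, v1 form** (the conclusion without the `IsRelPrime` conjunct): literally the hypothesis `h1` of
`rationalShortRootRigidity_of_reduce` (p673165). -/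
theorem stub_reduce' :
    ∀ N D : MvPolynomial (Fin 4) ℝ,
      (∀ (σ : Equiv.Perm (Fin 4)) (ε : Fin 4 → ℝ), (∀ i, ε i = 1 ∨ ε i = -1) →
        ∀ p : Fin 4 → ℝ, MvPolynomial.eval (fun i => ε i * p (σ i)) N = MvPolynomial.eval p N) →
      (∀ (σ : Equiv.Perm (Fin 4)) (ε : Fin 4 → ℝ), (∀ i, ε i = 1 ∨ ε i = -1) →
        ∀ p : Fin 4 → ℝ, MvPolynomial.eval (fun i => ε i * p (σ i)) D = MvPolynomial.eval p D) →
      (∀ p : Fin 4 → ℝ, MvPolynomial.eval (fun i => p i - (∑ j, p j) / 2) N = MvPolynomial.eval p N) →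
      (∀ p : Fin 4 → ℝ, MvPolynomial.eval (fun i => p i - (∑ j, p j) / 2) D = MvPolynomial.eval p D) →
      MvPolynomial.coeff (Finsupp.single 0 D.totalDegree) D ≠ 0 →
      N.totalDegree ≤ D.totalDegree + 2 →
      (∀ q : Fin 3 → ℝ, q ≠ 0 → ∃ (k : ℕ) (ω r : Fin k → ℝ) (c : Polynomial ℝ),
        (∀ j, 0 < ω j) ∧ (∀ j, 0 ≤ r j) ∧
        ∀ t : ℝ, MvPolynomial.eval (Fin.cons t q) N =
          MvPolynomial.eval (Fin.cons t q) D * (c.eval (t ^ 2) + ∑ j, r j / (t ^ 2 + ω j ^ 2))) →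
      ∃ N₀ D₀ : MvPolynomial (Fin 4) ℝ, N * D₀ = D * N₀ ∧ D₀ ≠ 0 ∧
        (∀ (σ : Equiv.Perm (Fin 4)) (ε : Fin 4 → ℝ), (∀ i, ε i = 1 ∨ ε i = -1) →
          ∀ p : Fin 4 → ℝ, MvPolynomial.eval (fun i => ε i * p (σ i)) N₀ = MvPolynomial.eval p N₀) ∧
        (∀ (σ : Equiv.Perm (Fin 4)) (ε : Fin 4 → ℝ), (∀ i, ε i = 1 ∨ ε i = -1) →
          ∀ p : Fin 4 → ℝ, MvPolynomial.eval (fun i => ε i * p (σ i)) D₀ = MvPolynomial.eval p D₀) ∧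
        (∀ p : Fin 4 → ℝ, MvPolynomial.eval (fun i => p i - (∑ j, p j) / 2) N₀ = MvPolynomial.eval p N₀) ∧
        (∀ p : Fin 4 → ℝ, MvPolynomial.eval (fun i => p i - (∑ j, p j) / 2) D₀ = MvPolynomial.eval p D₀) ∧
        MvPolynomial.coeff (Finsupp.single 0 D₀.totalDegree) D₀ ≠ 0 ∧
        N₀.totalDegree ≤ D₀.totalDegree + 2 ∧
        (∀ q : Fin 3 → ℝ, q ≠ 0 → ∃ (k : ℕ) (ω r : Fin k → ℝ) (c : Polynomial ℝ),
          (∀ j, 0 < ω j) ∧ (∀ j, 0 ≤ r j) ∧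
          ∀ t : ℝ, MvPolynomial.eval (Fin.cons t q) N₀ =
            MvPolynomial.eval (Fin.cons t q) D₀ * (c.eval (t ^ 2) + ∑ j, r j / (t ^ 2 + ω j ^ 2))) ∧
        (∀ q : Fin 4 → ℝ, (∑ i, q i * (fun i : Fin 4 => if i = 0 then (1 : ℝ) else 0) i) = 0 →
          ∀ z : ℂ, MvPolynomial.aeval
            (fun i => z * ((fun i : Fin 4 => if i = 0 then (1 : ℝ) else 0) i : ℂ) + (q i : ℂ)) D₀ = 0 → z.re = 0) ∧
        (∀ q : Fin 4 → ℝ, (∑ i, q i * (fun _ : Fin 4 => (1 : ℝ) / 2) i) = 0 →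
          ∀ z : ℂ, MvPolynomial.aeval (fun i => z * ((fun _ : Fin 4 => (1 : ℝ) / 2) i : ℂ) + (q i : ℂ)) D₀ = 0 →
            z.re = 0) := by
  intro N D hBN hBD hHN hHD hfull hdeg hAS
  obtain ⟨N₀, D₀, h1, h2, -, h4, h5, h6, h7, h8, h9, h10, h11, h12⟩ := stub_reduce N D hBN hBD hHN hHD hfull hdeg hAS
  exact ⟨N₀, D₀, h1, h2, h4, h5, h6, h7, h8, h9, h10, h11, h12⟩

end Summit.QuantumFields.YangMills.Theorems.RationalShortRootRigidity
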